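import Summits.QuantumFields.YangMills.Theorems.BalabanUVNodesN07CritTangentAtRecord
import Literature.MathematicalPhysics.QuantumFieldTheory.Balaban1983to89.BlockAveragingEMLProp2
import Literature.MathematicalPhysics.QuantumFieldTheory.Balaban1983to89.Node00.BackgroundCurrentShape

/-!
# BalabanUVNodes ∕ N07 — CURVE-CRITICAL ⇒ TANGENT-CRITICAL FOR EVERY MEMBER OF THE CLASS `|U(∂p) − 1| < ε₀η_k²` (module 35d of GAP-STATED(submersion)):
# the smallness hypothesis of 35c discharged by [B7] Proposition 2 for the averaging of record

Cell `pub-ymgap`, seat `pub-ymgap-dag-n07-e` generation 14 (R141 (C), DAG node N07 = [15]; MODULE 35d; INBOX INTENT-35d).  `--kind proof --supports stmt-QuantumFields-20541`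
(count-neutral).  CONSUMED BY NAME: this seat's g2 `Node00.CriticalOfRecord` (`IsCritOfRecord`, `ResidZ.pinCrit`,
`isCritOfRecord_of_isBackground`), 35c `N07CritTangentAtRecord.hasDerivAt_wilsonAction4_expChart_of_isCritOfRecord_of_small`, the tree's
`BlockAveragingEMLProp2.plaqSmall_iter_blockAvg_eml_level` ([B7] Prop. 2 (52)–(54) PROVED for (0.4), n21-c), NODE 00's classes `bgReg` ([I] (1.2), plaquette
clause) and `InUkClassB11` ([15] (2) at `Ω_j = T`, n01-b's `BackgroundCurrentShape`).

WHY.  35c's ★★★ asks that the iterated averages `Ū^i`, `i < k`, be `t₀`-small; for a member of the class of the variational problem of record — `U ∈ bgReg F N K k ε₀`,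
i.e. `|U(∂p) − 1| < ε₀η_k²` on the finest torus ([15] (2), scale `k`, no holes) — [B7] Proposition 2 gives `|Ū^i(∂p) − 1| < 2ε₀(L^iη_k)² ≤ 2ε₀` at every level `i ≤ k`
(`plaqSmall_iter_blockAvg_eml_level`, for `143·((d+4)²∕4)²·ε₀ ≤ 1∕3` and `ε₀ ≤ δ_N∕((d+4)L)²`).  So at NODE 00's crit-pinned layer (`IsCritOfRecord`, this seat's g2;
ζ.pinCrit of `BalabanUVNodesN07AtRecordCritPinned`) the reading GAP-STATED(submersion) disappears for EVERY member of the class once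
`ε₀ ≤ c(d, L, N)` (four explicit numeric ceilings): CURVE-critical ⇒ `d∕dt A(U·exp(tX))∣₀ = 0` for every kernel direction `X`.

HONEST FRAMING: count-neutral; nothing of [15]'s estimates; the ceilings on `ε₀` are the tree's ([B7] Prop. 2 radius, the corrector's `|I|⁻¹∕16`, the guard `δ_N`),
not print's `a₀`; multi-scale `genSet` NOT treated; V16 stub 1 ∕ K0⁷ NOT closed; N07 NOT discharged (5∕27); one finite T⁴ programme at fixed ε — NOT continuum ∕ ℝ⁴ ∕ OS ∕
mass gap ∕ Clay.  No `sorry`, no `def`.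
-/

noncomputable section

open scoped Matrix.Norms.L2Operator Topology
open Filter Function NormedSpace

namespace Summit.QuantumFields.YangMills.BalabanUVNodes.N07CritTangentInClass

open Literature.MathematicalPhysics.QuantumFieldTheory.Balaban1983to89
open Literature.MathematicalPhysics.QuantumFieldTheory.Balaban1983to89.T4Continuum (T4Family)
open Literature.MathematicalPhysics.QuantumFieldTheory.Balaban1983to89.B15DeterminingSets
open Literature.MathematicalPhysics.QuantumFieldTheory.Balaban1983to89.BlockAveraging
open Literature.MathematicalPhysics.QuantumFieldTheory.Balaban1983to89.BlockAveragingEMLHaarAC (emlWeight)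
open Literature.MathematicalPhysics.QuantumFieldTheory.Balaban1983to89.ExpMeanLog (expMeanLogSU deltaSU deltaSU_pos)
open Literature.MathematicalPhysics.QuantumFieldTheory.Balaban1983to89.T4AdjointCovarianceUnitary (lieSU)
open Literature.MathematicalPhysics.QuantumFieldTheory.Balaban1983to89.Node00
open Summit.QuantumFields.YangMills.Theorems.BlockAvgCorrector (stokesConst)
open Summit.QuantumFields.YangMills.BalabanUVNodes.N07CritTangentAtRecord

variable {F : T4Family} {N : ℕ} [NeZero N]

/-- **[B7] PROP. 2 AT THE RECORD, READ AS THE SMALLNESS 35c WANTS**: a member of `bgReg F N K k ε₀` (`|U(∂p) − 1| < ε₀η_k²`) has `2ε₀`-small iterated averages `Ū^i`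
at every level `i ≤ k`, provided `143·((d+4)²∕4)²·ε₀ ≤ 1∕3` and `2ε₀ ≤ 2δ_N∕((d+4)L)²` (`BlockAveragingEMLProp2.plaqSmall_iter_blockAvg_eml_level` and `(L^iη_k)² ≤ 1`).
[cite: Balaban1985Averaging, Prop. 2 (52)–(54) p.26; Balaban1985Variational, (2) p.278] -/
theorem plaqSmall_avgFamily_of_mem_bgReg {K k : ℕ} {ε₀ : ℝ} (hε₀ : 0 < ε₀)
    (h3 : (143 * (((((F.P K).d + 4 : ℕ) : ℝ)) ^ 2 / 4) ^ 2) * ε₀ ≤ 1 / 3)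
    (h2 : 2 * ε₀ ≤ 2 * deltaSU (Fin N) / ((((F.P K).d + 4) * (F.P K).L : ℕ) : ℝ) ^ 2)
    {U : GaugeField (F.P K) 0 (SU N)} (hU : U ∈ bgReg F N K k ε₀) {i : ℕ} (hi : i ≤ k) :
    PlaqSmall (2 * ε₀) (avgFamily (avOfRecord F N K) U i) := by
  have h52 : PlaqSmall (ε₀ * ((((F.P K).L : ℝ) ^ k)⁻¹) ^ 2) U := by
    intro p
    have := (mem_bgReg_iff F N K k ε₀ U).1 hU p
    rwa [Params.eta, inv_pow] at this
  have hlev := BlockAveragingEMLProp2.plaqSmall_iter_blockAvg_eml_level (n := Fin N) k hε₀ h3 h2 h52 hi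
  have hL1 : (1 : ℝ) ≤ (F.P K).L := by exact_mod_cast (F.P K).L_pos
  have hratio : (((F.P K).L : ℝ) ^ i * (((F.P K).L : ℝ) ^ k)⁻¹) ^ 2 ≤ 1 := by
    have hLk : (0 : ℝ) < ((F.P K).L : ℝ) ^ k := by positivity
    have hle : ((F.P K).L : ℝ) ^ i ≤ ((F.P K).L : ℝ) ^ k := pow_le_pow_right₀ hL1 hi
    have h01 : ((F.P K).L : ℝ) ^ i * (((F.P K).L : ℝ) ^ k)⁻¹ ≤ 1 := by
      rw [← div_eq_mul_inv, div_le_one hLk]; exact hle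
    have h00 : 0 ≤ ((F.P K).L : ℝ) ^ i * (((F.P K).L : ℝ) ^ k)⁻¹ := by positivity
    calc (((F.P K).L : ℝ) ^ i * (((F.P K).L : ℝ) ^ k)⁻¹) ^ 2 ≤ 1 ^ 2 := pow_le_pow_left₀ h00 h01 2
      _ = 1 := one_pow 2
  intro p
  refine (hlev p).trans_le ?_
  calc 2 * ε₀ * (((F.P K).L : ℝ) ^ i * (((F.P K).L : ℝ) ^ k)⁻¹) ^ 2 ≤ 2 * ε₀ * 1 := by
        exact mul_le_mul_of_nonneg_left hratio (by linarith)
    _ = 2 * ε₀ := mul_one _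

/-- ★★★ **CURVE-CRITICAL ⇒ TANGENT-CRITICAL FOR EVERY MEMBER OF THE CLASS, `ε₀ ≤ c(d, L, N)`.**  At NODE 00's objects, at a level `k ≤ m + K`, for `ε₀ > 0` below the four
explicit ceilings (`143·((d+4)²∕4)²·ε₀ ≤ 1∕3`; `2ε₀ ≤ 2δ_N∕((d+4)L)²`; `stokesConst·2ε₀ < |I|⁻¹∕16`; `stokesConst·2ε₀ < δ_N`): every `U` of the class `bgReg F N K k ε₀`
(`|U(∂p) − 1| < ε₀η_k²`, [15] (2) at scale `k`, no holes) which is a critical configuration of (5) on `𝔅_k(Ū^k(U))` in the CURVE form (`IsCritOfRecord`) satisfies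
`d∕dt A(U·exp(tX))∣_{t=0} = 0` for every kernel direction `X` of the linearised `k`-fold averaging (velocity form) — print's (82) on (83), the reading
GAP-STATED(submersion) gone at the crit-pinned layer for the whole class. [cite: Balaban1985Variational, (2),(3),(5) p.278, (82)–(83) p.290, (141) p.299, p.300, Prop. 8 p.304; Balaban1985Averaging, Prop. 2 p.26; Balaban1987RG1, (0.4) p.253] -/
theorem hasDerivAt_wilsonAction4_expChart_of_isCritOfRecord_of_mem_bgReg {K k : ℕ} (hk : k ≤ (F.P K).m + (F.P K).K) {ε₀ : ℝ} (hε₀ : 0 < ε₀)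
    (h3 : (143 * (((((F.P K).d + 4 : ℕ) : ℝ)) ^ 2 / 4) ^ 2) * ε₀ ≤ 1 / 3)
    (h2 : 2 * ε₀ ≤ 2 * deltaSU (Fin N) / ((((F.P K).d + 4) * (F.P K).L : ℕ) : ℝ) ^ 2)
    (hst : stokesConst (F.P K) * (2 * ε₀) < emlWeight (F.P K) / 16) (hstδ : stokesConst (F.P K) * (2 * ε₀) < deltaSU (Fin N))
    {U : GaugeField (F.P K) 0 (SU N)} (hU : U ∈ bgReg F N K k ε₀)
    (hcrit : IsCritOfRecord F N K k (avgFamily (avOfRecord F N K) U k) U)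
    {X : PBond (F.P K) 0 → lieSU (Fin N)}
    (hX : ∀ c : PBond (F.P K) k, HasDerivAt
      (fun t : ℝ => ((avgFamily (avOfRecord F N K) (expChart U (t • X)) k c : SU N) : Matrix (Fin N) (Fin N) ℂ)) 0 0) :
    HasDerivAt (fun t : ℝ => wilsonAction4 (expChart U (t • X))) 0 0 :=
  hasDerivAt_wilsonAction4_expChart_of_isCritOfRecord_of_small hk (by linarith) hst hstδ
    (fun i hi => plaqSmall_avgFamily_of_mem_bgReg hε₀ h3 h2 hU hi.le) hcrit hX

/-- The same with the conclusion `deriv … 0 = 0`. [cite: Balaban1985Variational, (82) p.290 (bookkeeping)] -/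
theorem deriv_wilsonAction4_expChart_eq_zero_of_isCritOfRecord_of_mem_bgReg {K k : ℕ} (hk : k ≤ (F.P K).m + (F.P K).K) {ε₀ : ℝ} (hε₀ : 0 < ε₀)
    (h3 : (143 * (((((F.P K).d + 4 : ℕ) : ℝ)) ^ 2 / 4) ^ 2) * ε₀ ≤ 1 / 3)
    (h2 : 2 * ε₀ ≤ 2 * deltaSU (Fin N) / ((((F.P K).d + 4) * (F.P K).L : ℕ) : ℝ) ^ 2)
    (hst : stokesConst (F.P K) * (2 * ε₀) < emlWeight (F.P K) / 16) (hstδ : stokesConst (F.P K) * (2 * ε₀) < deltaSU (Fin N))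
    {U : GaugeField (F.P K) 0 (SU N)} (hU : U ∈ bgReg F N K k ε₀)
    (hcrit : IsCritOfRecord F N K k (avgFamily (avOfRecord F N K) U k) U)
    {X : PBond (F.P K) 0 → lieSU (Fin N)}
    (hX : ∀ c : PBond (F.P K) k, HasDerivAt
      (fun t : ℝ => ((avgFamily (avOfRecord F N K) (expChart U (t • X)) k c : SU N) : Matrix (Fin N) (Fin N) ℂ)) 0 0) :
    deriv (fun t : ℝ => wilsonAction4 (expChart U (t • X))) 0 = 0 :=
  (hasDerivAt_wilsonAction4_expChart_of_isCritOfRecord_of_mem_bgReg hk hε₀ h3 h2 hst hstδ hU hcrit hX).deriv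

/-- ★★★ **THE SAME FOR [15] (2)'s FULL SPACE `𝔘_k({T}, ε₀)` AT THE RECORD** (`Node00.InUkClassB11`, both clauses of (2), no holes; its plaquette half is `bgReg` —
`InUkClassB11.mem_bgReg`): CURVE-critical on `𝔅_k(Ū^k(U))` ⇒ TANGENT-critical in every kernel direction, for `ε₀ ≤ c(d, L, N)`.
[cite: Balaban1985Variational, (2),(3),(5)–(6) p.278, (82)–(83) p.290, (141) p.299, p.300; Balaban1985Averaging, Prop. 2 p.26] -/
theorem hasDerivAt_wilsonAction4_expChart_of_isCritOfRecord_of_inUkClassB11 {K k : ℕ} (hk : k ≤ (F.P K).m + (F.P K).K) {ε₀ : ℝ} (hε₀ : 0 < ε₀)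
    (h3 : (143 * (((((F.P K).d + 4 : ℕ) : ℝ)) ^ 2 / 4) ^ 2) * ε₀ ≤ 1 / 3)
    (h2 : 2 * ε₀ ≤ 2 * deltaSU (Fin N) / ((((F.P K).d + 4) * (F.P K).L : ℕ) : ℝ) ^ 2)
    (hst : stokesConst (F.P K) * (2 * ε₀) < emlWeight (F.P K) / 16) (hstδ : stokesConst (F.P K) * (2 * ε₀) < deltaSU (Fin N))
    {U : GaugeField (F.P K) 0 (SU N)} (hU : InUkClassB11 F N K k ε₀ U)
    (hcrit : IsCritOfRecord F N K k (avgFamily (avOfRecord F N K) U k) U)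
    {X : PBond (F.P K) 0 → lieSU (Fin N)}
    (hX : ∀ c : PBond (F.P K) k, HasDerivAt
      (fun t : ℝ => ((avgFamily (avOfRecord F N K) (expChart U (t • X)) k c : SU N) : Matrix (Fin N) (Fin N) ℂ)) 0 0) :
    HasDerivAt (fun t : ℝ => wilsonAction4 (expChart U (t • X))) 0 0 :=
  hasDerivAt_wilsonAction4_expChart_of_isCritOfRecord_of_mem_bgReg hk hε₀ h3 h2 hst hstδ hU.mem_bgReg hcrit hX

/-! ## §2  At the crit-pinned residual layer `ζ.pinCrit` and for the minimiser of record `U_k(V)` -/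

/-- The standing range from a member index: `i.k ≤ i.K = (F.P i.K).K ≤ m + K`. [cite: Balaban1987RG1, (0.1) p.251 (bookkeeping)] -/
theorem k_le_range (i : ZIdx) : i.k ≤ (F.P i.K).m + (F.P i.K).K := by
  rw [T4Family.P_K]
  exact i.hk.trans (Nat.le_add_left _ _)

/-- ★★★ **AT THE CRIT-PINNED LAYER `ζ.pinCrit`** (this seat's g2; the N07 closers of `BalabanUVNodesN07AtRecordCritPinned`): a member `U` of [15] (2)'s space at `ε₀ = e ≤ c`
lying on the fibre `Ū^k = V` and critical there in the pinned (CURVE) sense `ζ.pinCrit.IsCrit i V U` is TANGENT-critical in every kernel direction.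
[cite: Balaban1985Variational, (2)–(6) p.278, Props 7–8 pp.299–304, (141) p.299, p.300] -/
theorem hasDerivAt_wilsonAction4_expChart_of_pinCrit_isCrit (ζ : ResidZ F N) (i : ZIdx) {e : ℝ} (he : 0 < e)
    (h3 : (143 * (((((F.P i.K).d + 4 : ℕ) : ℝ)) ^ 2 / 4) ^ 2) * e ≤ 1 / 3)
    (h2 : 2 * e ≤ 2 * deltaSU (Fin N) / ((((F.P i.K).d + 4) * (F.P i.K).L : ℕ) : ℝ) ^ 2)
    (hst : stokesConst (F.P i.K) * (2 * e) < emlWeight (F.P i.K) / 16) (hstδ : stokesConst (F.P i.K) * (2 * e) < deltaSU (Fin N))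
    {V : GaugeField (F.P i.K) i.k (SU N)} {U : GaugeField (F.P i.K) 0 (SU N)} (hU : InUkClassB11 F N i.K i.k e U)
    (hV : avgFamily (avOfRecord F N i.K) U i.k = V) (hcrit : ζ.pinCrit.IsCrit i V U)
    {X : PBond (F.P i.K) 0 → lieSU (Fin N)}
    (hX : ∀ c : PBond (F.P i.K) i.k, HasDerivAt
      (fun t : ℝ => ((avgFamily (avOfRecord F N i.K) (expChart U (t • X)) i.k c : SU N) : Matrix (Fin N) (Fin N) ℂ)) 0 0) :
    HasDerivAt (fun t : ℝ => wilsonAction4 (expChart U (t • X))) 0 0 := by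
  subst hV
  exact hasDerivAt_wilsonAction4_expChart_of_isCritOfRecord_of_inUkClassB11 (k_le_range i) he h3 h2 hst hstδ hU hcrit hX

/-- ★★★ **THE MINIMISER OF RECORD IS TANGENT-CRITICAL** — [15] p. 299 «U_k … is a critical configuration of the functional (5)» with «critical» in print's TANGENT
sense (141)∕(82), at NODE 00's objects: a background `U = U_k(V)` of the variational problem of record over [15] (2)'s space at `ε₀ = e ≤ c(d, L, N)`
(`IsBackground (avOfRecord F N K) {InUkClassB11 … e} k V U`: on the fibre, in the class, minimal) has `d∕dt A(U·exp(tX))∣₀ = 0` for every kernel direction `X` of the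
linearised `k`-fold averaging — «minimal ⇒ curve-critical» (g2 `isCritOfRecord_of_isBackground`) composed with 35c∕35d.
[cite: Balaban1985Variational, Thm 1 p.279, (141) p.299, p.300, (82)–(83) p.290; Balaban1987RG1, (0.21), (1.1)–(1.2) pp.256–260] -/
theorem hasDerivAt_wilsonAction4_expChart_of_isBackground {K k : ℕ} (hk : k ≤ (F.P K).m + (F.P K).K) {e : ℝ} (he : 0 < e)
    (h3 : (143 * (((((F.P K).d + 4 : ℕ) : ℝ)) ^ 2 / 4) ^ 2) * e ≤ 1 / 3)
    (h2 : 2 * e ≤ 2 * deltaSU (Fin N) / ((((F.P K).d + 4) * (F.P K).L : ℕ) : ℝ) ^ 2)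
    (hst : stokesConst (F.P K) * (2 * e) < emlWeight (F.P K) / 16) (hstδ : stokesConst (F.P K) * (2 * e) < deltaSU (Fin N))
    {V : GaugeField (F.P K) k (SU N)} {U : GaugeField (F.P K) 0 (SU N)}
    (h : IsBackground (avOfRecord F N K) {U | InUkClassB11 F N K k e U} k V U)
    {X : PBond (F.P K) 0 → lieSU (Fin N)}
    (hX : ∀ c : PBond (F.P K) k, HasDerivAt
      (fun t : ℝ => ((avgFamily (avOfRecord F N K) (expChart U (t • X)) k c : SU N) : Matrix (Fin N) (Fin N) ℂ)) 0 0) :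
    HasDerivAt (fun t : ℝ => wilsonAction4 (expChart U (t • X))) 0 0 := by
  have hV : avgFamily (avOfRecord F N K) U k = V := h.1
  subst hV
  exact hasDerivAt_wilsonAction4_expChart_of_isCritOfRecord_of_inUkClassB11 hk he h3 h2 hst hstδ h.2.1 (isCritOfRecord_of_isBackground h) hX

/-- **NON-VACUITY OF THE CEILINGS**: the four numeric conditions on `ε₀` hold for every sufficiently small `ε₀ > 0` (all right-hand sides are positive), e.g. there
is such an `ε₀`. [cite: Balaban1985Variational, (2) p.278 (bookkeeping)] -/
theorem exists_admissible_eps (P : Params) (N : ℕ) [NeZero N] : ∃ ε₀ : ℝ, 0 < ε₀ ∧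
    (143 * ((((P.d + 4 : ℕ) : ℝ)) ^ 2 / 4) ^ 2) * ε₀ ≤ 1 / 3 ∧
    2 * ε₀ ≤ 2 * deltaSU (Fin N) / (((P.d + 4) * P.L : ℕ) : ℝ) ^ 2 ∧
    stokesConst P * (2 * ε₀) < emlWeight P / 16 ∧ stokesConst P * (2 * ε₀) < deltaSU (Fin N) := by
  haveI : Nonempty (Fin N) := ⟨⟨0, Nat.pos_of_ne_zero (NeZero.ne N)⟩⟩
  have hδ : 0 < deltaSU (Fin N) := deltaSU_pos
  have hw : 0 < emlWeight P := Summit.QuantumFields.YangMills.Theorems.BlockAvgCorrector.emlWeight_pos P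
  have hst : 0 ≤ stokesConst P := Summit.QuantumFields.YangMills.Theorems.BlockAvgCorrector.stokesConst_nonneg P
  have hC : 0 < 143 * ((((P.d + 4 : ℕ) : ℝ)) ^ 2 / 4) ^ 2 := by positivity
  have hD : 0 < (((P.d + 4) * P.L : ℕ) : ℝ) ^ 2 := by
    have : 0 < ((P.d + 4) * P.L : ℕ) := Nat.mul_pos (by omega) P.L_pos
    positivity
  -- a positive quantity below every ceiling
  obtain ⟨ε₀, hε₀, hsmall⟩ : ∃ ε₀ : ℝ, 0 < ε₀ ∧ ε₀ < min (min ((1 / 3) / (143 * ((((P.d + 4 : ℕ) : ℝ)) ^ 2 / 4) ^ 2))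
      (deltaSU (Fin N) / (((P.d + 4) * P.L : ℕ) : ℝ) ^ 2))
      (min ((emlWeight P / 16) / (2 * (stokesConst P + 1))) (deltaSU (Fin N) / (2 * (stokesConst P + 1)))) := by
    refine exists_between ?_
    refine lt_min (lt_min (by positivity) (by positivity)) (lt_min (by positivity) (by positivity))
  refine ⟨ε₀, hε₀, ?_, ?_, ?_, ?_⟩
  · have h := (lt_min_iff.1 (lt_min_iff.1 hsmall).1).1
    rw [lt_div_iff₀ hC] at h
    linarith [mul_comm ε₀ (143 * ((((P.d + 4 : ℕ) : ℝ)) ^ 2 / 4) ^ 2)]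
  · have h := (lt_min_iff.1 (lt_min_iff.1 hsmall).1).2
    have : 2 * ε₀ ≤ 2 * (deltaSU (Fin N) / (((P.d + 4) * P.L : ℕ) : ℝ) ^ 2) := by linarith
    rwa [mul_div_assoc] 
  · have h := (lt_min_iff.1 (lt_min_iff.1 hsmall).2).1
    rw [lt_div_iff₀ (by positivity)] at h
    nlinarith
  · have h := (lt_min_iff.1 (lt_min_iff.1 hsmall).2).2
    rw [lt_div_iff₀ (by positivity)] at h
    nlinarith

end Summit.QuantumFields.YangMills.BalabanUVNodes.N07CritTangentInClass

end
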